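import Mathlib
import HarnessLib
import Summits.NavierStokesRegularity.NavierStokesRegularity.Theorems.UnthreadedDoorCellFluxDefs
import Summits.NavierStokesRegularity.NavierStokesRegularity.Theorems.UnthreadedDoorCellFluxClassOscCritical
import Summits.NavierStokesRegularity.NavierStokesRegularity.Theorems.UnthreadedDoorCellFluxHeadCoherentOfAnalytic
import Summits.NavierStokesRegularity.NavierStokesRegularity.Theorems.UnthreadedDoorCellFluxSphereOpenDiffFinite

/-!
# Route `UnthreadedDoor`, crux `PoloidalLiouville` (stmt-NavierStokesRegularity-1222), WALL W1 — crux idea «cell-flux»: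
# ★★ EVERY CELL OF AN ANALYTIC SLICE IS HEAD-COHERENT (`CellFlux.HeadCoherent f g L (cellOf f x₀ r x)`), BY NAME

Support file (seat leafhand-ns-unthreadeddoor-3 g7, cell decomp-ns), `--supports stmt-NavierStokesRegularity-1222 --as helper`; theorems only.

The docstring of `CellFlux.HeadCoherent` (`…UnthreadedDoorCellFluxDefs`, p692073) books «on one cell of an analytic slice this is the cell
version of K1⁺».  Assembled here from the three bricks of this seat: the cell form of K1⁺ (`NetFlux.slice_le_of_analytic_regular_on[_closure]`,
p828908), its `HeadCoherent` packaging (`headCoherent_of_analytic_regular_on`, p828998) and the topology of cells (`isPreconnected_sphere_inter_diff_finite`,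
`sphere_inter_subset_closure_diff_finite`, p829115), together with the tree's «cells are relatively open» (`exists_cap_subset_cellOf`, ARM A):

* `exists_isOpen_cellOf_eq` — a cell is `S_r(x₀) ∩ O` for an open `O`;
* `isPreconnected_cellOf_diff_finite`, `cellOf_subset_closure_diff_finite` — a cell minus a finite set is preconnected and dense in the cell;
* ★★ `headCoherent_cellOf` — `f, μ` analytic and `g ∈ C¹` off `x₀`, `∇g − μ∇f ∥ (x − x₀)` and `|μ| ≤ L` on `S_r(x₀)` (`r > 0`), finitely many
  ISOLATED sphere-critical points (`(isoCrit f x₀ r).Finite`, e.g. from `cellFinitePred`) ⇒ `HeadCoherent f g L (cellOf f x₀ r x)` for EVERY `x`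
  (multi-hill cells included: no saddle-freeness, no Morse hypothesis);
* ★★ `headCoherent_cellOf_of_linked_analytic` — the same in the binders of Λ-1 `HeadClusterRuleTame` / `AdmissibleRule` at one instant
  (`‖v‖ ≤ V` on the sphere ⇒ constant `r·V`).

So the finest rule (cells) satisfies the head-coherence clause of `AdmissibleRule` on the count-free analytic stratum; what Λ-1 still has to
supply is the EVENT bookkeeping (joint continuity of the cluster flux through births / deaths / reconnections of sheet traces, preconnected
ranges).  HONEST LABEL: Λ-1, Λ-2, Σ-0bR₂, Σ-0e, C⁻, `PoloidalLiouville` (1222), W1 and NS regularity stay OPEN; no summit statement is proved.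
[folklore]
-/

noncomputable section

set_option linter.dupNamespace false

open Set Function Filter Topology Metric
open scoped RealInnerProductSpace

namespace Summit.NavierStokesRegularity.NavierStokesRegularity.Theorems.PoloidalLiouville.CellFlux

open Summit.NavierStokesRegularity.NavierStokesRegularity.Theorems.PoloidalLiouville.NetFlux (E3)
open Literature.Analysis Literature.Analysis.FluidPDE

variable {f g μ : E3 → ℝ} {x₀ : E3} {r L : ℝ}

/-! ### 1. A cell is a relatively open subset of the sphere -/

/-- **A cell is `S_r(x₀) ∩ O` for an open `O`** (union of the caps of `exists_cap_subset_cellOf` around its points; `f ∈ C¹` off `x₀`,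
`r > 0`). [folklore] -/
theorem exists_isOpen_cellOf_eq (hr : 0 < r) (hf : ContDiffOn ℝ 1 f ({x₀}ᶜ : Set E3)) (x : E3) :
    ∃ O : Set E3, IsOpen O ∧ cellOf f x₀ r x = Metric.sphere x₀ r ∩ O := by
  classical
  have hcap : ∀ z ∈ cellOf f x₀ r x, ∃ ε > (0 : ℝ), Metric.sphere x₀ r ∩ Metric.ball z ε ⊆ cellOf f x₀ r x := by
    intro z hz
    have hzS : z ∈ Metric.sphere x₀ r \ sheetTrace f x₀ r := connectedComponentIn_subset _ _ hz
    obtain ⟨ε, hε, hsub⟩ := exists_cap_subset_cellOf hr hf hzS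
    have hEq : cellOf f x₀ r x = cellOf f x₀ r z := connectedComponentIn_eq hz
    exact ⟨ε, hε, by rw [hEq]; exact hsub⟩
  choose! ε hε hsub using hcap
  refine ⟨⋃ z ∈ cellOf f x₀ r x, Metric.ball z (ε z), isOpen_biUnion fun z _ => Metric.isOpen_ball, ?_⟩
  ext y
  constructor
  · intro hy
    exact ⟨(connectedComponentIn_subset _ _ hy).1, mem_biUnion hy (Metric.mem_ball_self (hε y hy))⟩
  · rintro ⟨hyS, hyU⟩
    obtain ⟨z, hz, hyz⟩ := mem_iUnion₂.1 hyU
    exact hsub z hz ⟨hyS, hyz⟩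

/-- **A cell minus a finite set is preconnected.** [folklore] -/
theorem isPreconnected_cellOf_diff_finite (hr : 0 < r) (hf : ContDiffOn ℝ 1 f ({x₀}ᶜ : Set E3)) (x : E3) {F : Set E3}
    (hF : F.Finite) : IsPreconnected (cellOf f x₀ r x \ F) := by
  obtain ⟨O, hO, hEq⟩ := exists_isOpen_cellOf_eq hr hf x
  have hconn : IsPreconnected (Metric.sphere x₀ r ∩ O) := hEq ▸ isPreconnected_connectedComponentIn
  rw [hEq]
  exact isPreconnected_sphere_inter_diff_finite x₀ hr hO hconn hF

/-- **A finite set is nowhere dense in a cell.** [folklore] -/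
theorem cellOf_subset_closure_diff_finite (hr : 0 < r) (hf : ContDiffOn ℝ 1 f ({x₀}ᶜ : Set E3)) (x : E3) {F : Set E3}
    (hF : F.Finite) : cellOf f x₀ r x ⊆ closure (cellOf f x₀ r x \ F) := by
  obtain ⟨O, hO, hEq⟩ := exists_isOpen_cellOf_eq hr hf x
  rw [hEq]
  exact sphere_inter_subset_closure_diff_finite x₀ hr hO hF

/-! ### 2. ★★ Every cell of an analytic slice is head-coherent -/

/-- ★★ **Head coherence of a cell (the cell version of K1⁺, by name).**  On `S_r(x₀)` (`r > 0`) let `f, μ` be real-analytic and `g ∈ C¹`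
off `x₀`, `∇g − μ∇f ∥ (x − x₀)` and `|μ| ≤ L` on the sphere, and let the ISOLATED sphere-critical points be finitely many.  Then for every
`x`, `HeadCoherent f g L (cellOf f x₀ r x)`: ONE `L`-Lipschitz `G` with `g = G ∘ f` on the CLOSURE of the cell (its sheet-trace boundary and its
critical points included).  [The cell minus `isoCrit` is a preconnected set of regular points, dense in the cell.] [folklore] -/
theorem headCoherent_cellOf (hr : 0 < r) (hf : AnalyticOnNhd ℝ f ({x₀}ᶜ : Set E3)) (hμ : AnalyticOnNhd ℝ μ ({x₀}ᶜ : Set E3))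
    (hg : ContDiffOn ℝ 1 g ({x₀}ᶜ : Set E3))
    (hpar : ∀ x ∈ Metric.sphere x₀ r, cross (gradient g x - μ x • gradient f x) (x - x₀) = 0)
    (hL : ∀ x ∈ Metric.sphere x₀ r, |μ x| ≤ L) (hfin : (isoCrit f x₀ r).Finite) (x : E3) :
    HeadCoherent f g L (cellOf f x₀ r x) := by
  have hf1 : ContDiffOn ℝ 1 f ({x₀}ᶜ : Set E3) := hf.contDiffOn isOpen_compl_singleton.uniqueDiffOn
  set C : Set E3 := cellOf f x₀ r x \ isoCrit f x₀ r with hC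
  have hCconn : IsPreconnected C := isPreconnected_cellOf_diff_finite hr hf1 x hfin
  have hCS : C ⊆ Metric.sphere x₀ r := fun z hz => (connectedComponentIn_subset _ _ hz.1).1
  have hCreg : ∀ z ∈ C, cross (gradient f z) (z - x₀) ≠ 0 := by
    rintro z ⟨hz, hziso⟩ hcrit
    have hzS : z ∈ Metric.sphere x₀ r \ sheetTrace f x₀ r := connectedComponentIn_subset _ _ hz
    exact hziso ⟨⟨hzS.1, hcrit⟩, hzS.2⟩
  obtain ⟨G, hG, hGe⟩ := headCoherent_of_analytic_regular_on hr hf hμ hg hpar hL hCS hCreg hCconn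
  refine ⟨G, hG, fun y hy => hGe y ?_⟩
  exact closure_minimal (cellOf_subset_closure_diff_finite hr hf1 x hfin) isClosed_closure hy

/-- ★★ **Head coherence of every cell, in Λ-1's binders (one instant).**  `v` analytic on `ℝ³` with `‖v‖ ≤ V` on `S_r(x₀)` (`r > 0`), `T`
analytic and `P ∈ C¹` off `x₀`, head relation `(∇P − ⟪v, · − x₀⟫ ∇T) × (x − x₀) = 0` on the sphere, finitely many isolated sphere-critical
points of `T` ⇒ `HeadCoherent T P (r * V) (cellOf T x₀ r x)` for every `x` — the head-coherence clause of `AdmissibleRule` for the finest rule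
(cells) on the analytic count-free stratum. [folklore] -/
theorem headCoherent_cellOf_of_linked_analytic {v : E3 → E3} {T P : E3 → ℝ} {x₀ : E3} {r V : ℝ} (hr : 0 < r)
    (hv : AnalyticOnNhd ℝ v (univ : Set E3)) (hT : AnalyticOnNhd ℝ T ({x₀}ᶜ : Set E3))
    (hP : ContDiffOn ℝ 1 P ({x₀}ᶜ : Set E3))
    (hV : ∀ x ∈ Metric.sphere x₀ r, ‖v x‖ ≤ V)
    (hhead : ∀ x ∈ Metric.sphere x₀ r, cross (gradient P x - ⟪v x, x - x₀⟫ • gradient T x) (x - x₀) = 0)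
    (hfin : (isoCrit T x₀ r).Finite) (x : E3) :
    HeadCoherent T P (r * V) (cellOf T x₀ r x) :=
  headCoherent_cellOf (μ := fun y => ⟪v y, y - x₀⟫) hr hT
    ((NetFlux.analyticOnNhd_loopMomentum' hv x₀).mono (subset_univ _)) hP hhead
    (fun _ hx => abs_inner_sub_centre_le hV hx) hfin x

end Summit.NavierStokesRegularity.NavierStokesRegularity.Theorems.PoloidalLiouville.CellFlux

end
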